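import Summits.QuantumFields.YangMills.Theses.InfraredLiouville

/-!
# Birth skeleton (BC3) for crux `GapToContinuum` — item **stmt-QuantumFields-15914** — `Lines/birth_stmt15914.lean`

Registrar: `planner-skel-stmt-QuantumFields-15914-0` (skeleton-register one-shot; primary route
`route-QuantumFields-InfraredLiouville`, rank 5; the item is SHARED verbatim with
`route-QuantumFields-ModularSelfDualFold`, rank 3; re-audit bin REPAIRABLE), 2026-08-17.

**Path note.** The directory `Cruxes/GapToContinuum/` is shared by three items whose decl is named
`GapToContinuum` (stmt-8896 = `LangevinControlUV.GapToContinuum`, a DIFFERENT statement, whose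
registered birth skeleton already occupies `Lines/birth.lean`; stmt-8902 retired; stmt-15914 = this
one).  To avoid clobbering the 8896 registration this skeleton is published as
`Lines/birth_stmt15914.lean` (+ card `Lines/birth_stmt15914.md`).  The directory's `Disproof.lean`,
`STRATEGY-CENSUS.md`, `Retype.lean`, dead lines and triage files all concern stmt-8896, not this item.

## The crux (route file `Theses/InfraredLiouville.lean`, decl `Summit.QuantumFields.YangMills.Theses.InfraredLiouville.GapToContinuum`)

For every compact simple `G` (any Borel structure) and every `r : LatticeRep G`:
(L) `∃ β₁ m, (∀ β ≥ β₁, 0 < m β) ∧ ∀ A B, ∃ C S₀, ∀ β ≥ β₁, ∀ S ≥ S₀, ∀ n ≤ S,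
|latticeConnectedCorr r.ρ β (2S+1) A B n| ≤ C e^{-m(β) n}` (uniform weak-coupling lattice clustering,
β-uniform per-pair prefactors) ⟹ the Clay body for THIS `(G, r)`: `∃ sch T, sch.HasWeakCouplingLimit ∧
IsYangMillsFor r sch T ∧ T.IsNontrivial r.curvature ∧ T.IsNonGaussian r.curvature ∧ ∃ Δ > 0,
T.HasMassGap Δ ∧ HasLatticeMassGap r sch Δ`.
Grounder verdict: OPEN-PROBLEM (summit-strength conditional continuum leg).  Refuter rreview1
(evidence `CMinusNontriviality.lean`, `weakCoupling_vacuumScheme`): from (L) alone a weak-coupling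
VACUUM scheme already satisfies every conjunct except `IsNontrivial`/`IsNonGaussian` — the content of
the crux is a NON-TRIVIAL, NON-GAUSSIAN weak-coupling continuum limit carrying the gap.

## The cut — "lattice-mass units": ξ-divergence · massive scaling sequence · κ₃ · O(4) · OS assembly

The route text fixes the line ("β_k → ∞ with a_k locked to the lattice mass, a_k ≍ 1/ξ(β_k); needs
ξ(β) → ∞ (Chatterjee Problem 5.1), asymptotic scaling, O(4) restoration and a non-Gaussian limit").
The skeleton types exactly these as FIVE named stubs, the last four in the currency of route
`FlowLineStateSpace` (whose deciding theorem is the `∃ r` version of this composition), so that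
three of them are that route's typed items made pointwise in the Borel structure:

* `stub_xiDiverges` — **ξ → ∞ in (L)-currency** (new, this route): every (L)-valid rate function
  `m` for a compact SIMPLE `G` tends to `0` (`∀ m₀ > 0, ∀ᶠ β, m β < m₀`).  Strictly weaker than
  `DirichletWindow.XiDiverges` (stmt-8941, open) via the PROVED `criticalityOfXiDiverges_proof`
  (stmt-12318: an (L)-valid rate is a DirichletWindow-admissible rate after a finite maximum over
  `S < S₀(A,B)`, `n ≤ S`).  Why it might fail: it is Chatterjee's open Problem 5.1 (no weak-coupling
  lower bound on 4-d non-abelian plaquette correlations uniformly in the volume is in print); false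
  for `U(1)` (not simple; and there (L) fails in the Coulomb phase anyway).
* `stub_massiveSchemeOfLatticeGap` — **(L) + ξ → ∞ ⟹ a massive scaling sequence for the SAME `r`**
  (new, this route; conclusion = the body of `FlowLineStateSpace.MassiveScalingSequence`, stmt-9117,
  with its `∃ r` removed): a sequential scheme with (AF) `β_k → ∞`, (VS) exact vacuum subtraction of
  the curvature species, (UVB) `k`-uniform OS linear-growth bounds of the renormalised curvature
  functionals `LS_k` on general off-diagonal tensors, (ND) a `k`-uniform lower bound on one OS
  two-point value, (CL) `k`-uniform clustering at a physical rate in OS form, (ARP) asymptotic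
  reflection positivity, (GAP) `HasLatticeMassGap r sch Δ`.  Intended construction: `a_k := m(β_k)/Δ`
  (lattice-mass units; `a_k → 0` IS `stub_xiDiverges`), `L_k ≥ S₀`-thresholds, so (GAP) and (AF) are
  what (L) buys for free (refuter's `weakCoupling_vacuumScheme`); (UVB)+(ND) in THESE units are the
  two-sided crossover bounds = the 4-d UV construction with observables (Bałaban / MRS programme) —
  the load-bearing open content; (CL) needs pair-UNIFORM prefactors that the type of (L) (`∀ A B ∃ C`)
  does not supply.  Why it might fail: exactly those three.
* `stub_curvatureNonGaussianity` — verbatim `FlowLineStateSpace.CurvatureNonGaussianity` (stmt-9118,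
  XL) for an arbitrary Borel structure: some connected three-point function of the renormalised
  curvature stays `≥ δ` frequently in `k`.
* `stub_rotationRestoration` — verbatim `FlowLineStateSpace.RotationRestoration` (stmt-9119,
  open-problem, the E1 complement): `LS_k(R·F − F) → 0` for proper rotations `R`.
* `stub_osLimitFromUniformBounds` — verbatim `FlowLineStateSpace.OSLimitFromUniformBounds`
  (stmt-15926, the soft OS assembly: diagonal subsequence + Banach–Steinhaus + axioms through the
  limit; RESTATED 2026-08-16 form with the β-reindexing clause).
* `GapToContinuum_of` — the composition, a REAL proof (pure logic, the pointwise-in-`r` version of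
  `FlowLineStateSpace.closes`): open (L); ξ-divergence; massive scheme; κ₃ and O(4) along it; OS
  assembly returns `sch'` (a β-reindexing of `sch` along `φ → ∞`) and `T`; `sch'.HasWeakCouplingLimit`
  is `(AF).comp φ`.  `GapToContinuum_closed` instantiates it with the five stubs BY NAME (kernel check
  that antecedents = stub signatures); `GapToContinuum_of_msdf` is omitted on purpose (no second route
  import) — `ModularSelfDualFold.GapToContinuum` has the identical text (checked `diff`, registrar folder).

Every stub is stated in TREE VOCABULARY ONLY (no local abbreviation in a signature).  Relation to
`FlowLineStateSpace`'s items: the three verbatim stubs differ from stmt-9118/9119/15926 only by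
replacing `letI := borel G; haveI : BorelSpace G := ⟨rfl⟩` with instance binders
`[MeasurableSpace G] [BorelSpace G]` (the crux's own binders); since `BorelSpace G` is a `Prop`
forcing `‹MeasurableSpace G› = borel G`, a proof of the FlowLine item transports by
`subst BorelSpace.measurable_eq` (registrar folder `scratch/link.lean`).

## Disproof used
No `Disproof.lean` exists for stmt-15914 (the directory's one is stmt-8896's).  Honoured instead:
refuter rreview1's positive lemma (`weakCoupling_vacuumScheme`: everything but non-triviality is free
from (L)) — non-triviality is carried by (ND) in `stub_massiveSchemeOfLatticeGap` and by
`stub_curvatureNonGaussianity`, and turned into `IsNontrivial`/`IsNonGaussian` only inside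
`stub_osLimitFromUniformBounds`; `Literature.Barriers.QuantumFields.FixedCouplingUltralocality` — no
stub takes a limit at fixed or bounded `β` ((AF) is a conjunct of stub 2 and `a_k → 0` is forced
through `stub_xiDiverges`); negatives index (`ledger negatives --problem QuantumFields`, 2026-08-17: 5 refuted
statements — RobustYangMillsRG 14958, DiagonalMirrorRP 9665, AdaptiveCoarseSystem 9494,
MultibosonLatticeGap 9599, AdmissibleRootsExist 9603): no stub equals or restates one; the FlowLine
items reused here (9117-body, 9118, 9119, 15926) are open and unrefuted (its on-paper-refuted flow
cruxes 13917/13977 are not used).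

`lean check`: rc 0; sorries = 5 = stubs, zero elsewhere (audit quoted in `Lines/birth_stmt15914.md`).
Namespace `Summit.QuantumFields.YangMills.Cruxes.GapToContinuum.Birth15914`.
-/

noncomputable section

namespace Summit.QuantumFields.YangMills.Cruxes.GapToContinuum.Birth15914

open Literature.MathematicalPhysics.QuantumFieldTheory Literature.MathematicalPhysics.QuantumLattice
  Literature.MathematicalPhysics.AQFT Literature.Probability.LatticeModels

/-- The crux this skeleton closes (by name). -/
example : Prop := Summit.QuantumFields.YangMills.Theses.InfraredLiouville.GapToContinuum

/-- **Stub 1 — ξ-divergence in (L)-currency (OPEN; Chatterjee Problem 5.1).**  For a compact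
simple `G` and faithful `r`, every rate function `m` valid in the sense of the crux's hypothesis (L)
(β-uniform per-pair prefactors, pair-dependent volume thresholds) tends to `0` as `β → ∞`:
the lattice correlation length diverges at weak coupling, so that lattice-mass units `a_k ≍ m(β_k)`
reach the continuum.  Weaker than `DirichletWindow.XiDiverges` (stmt-8941) by the proved
`criticalityOfXiDiverges_proof` (stmt-12318) plus a finite maximum. -/
theorem stub_xiDiverges :
    ∀ (G : Type) [Group G] [TopologicalSpace G] [IsTopologicalGroup G] [CompactSpace G] [MeasurableSpace G] [BorelSpace G], IsCompactSimpleLieGroup G → ∀ (r : LatticeRep G) (β₁ : ℝ) (m : ℝ → ℝ), (∀ β : ℝ, β₁ ≤ β → 0 < m β) → (∀ A B : YMSpecies G, ∃ (C : ℝ) (S₀ : ℕ), ∀ β : ℝ, β₁ ≤ β → ∀ S : ℕ, S₀ ≤ S → ∀ n : ℕ, n ≤ S → |latticeConnectedCorr r.ρ β (2 * S + 1) A.F B.F n| ≤ C * Real.exp (-(m β * n))) → ∀ m₀ : ℝ, 0 < m₀ → ∀ᶠ β : ℝ in Filter.atTop, m β < m₀ := by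
  sorry

/-- **Stub 2 — a massive scaling sequence in lattice-mass units from (L) (OPEN; UV + crossover).**
For a compact simple `G`, faithful `r`, an (L)-valid rate `m` that tends to `0`: there is a
sequential scheme `sch` with (AF) `β_k → ∞`, (VS) exact vacuum subtraction of the curvature species,
(UVB) uniform OS linear-growth bounds of the renormalised curvature functionals on off-diagonal
tensors, (ND) a uniform lower bound on one OS two-point value, (CL) uniform clustering at a physical
rate in OS form, (ARP) asymptotic reflection positivity, (GAP) `HasLatticeMassGap r sch Δ` — the body
of `FlowLineStateSpace.MassiveScalingSequence` (stmt-9117) for THIS `r`.  Intended units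
`a_k := m(β_k)/Δ`, `L_k` above the (L)-thresholds: (AF), (VS), (GAP) are free from (L); (UVB)+(ND) in
these units are the two-sided crossover bounds of the 4-d construction with observables; (CL) needs
pair-uniform prefactors. -/
theorem stub_massiveSchemeOfLatticeGap :
    ∀ (G : Type) [Group G] [TopologicalSpace G] [IsTopologicalGroup G] [CompactSpace G] [MeasurableSpace G] [BorelSpace G], IsCompactSimpleLieGroup G → ∀ (r : LatticeRep G) (β₁ : ℝ) (m : ℝ → ℝ), (∀ β : ℝ, β₁ ≤ β → 0 < m β) → (∀ A B : YMSpecies G, ∃ (C : ℝ) (S₀ : ℕ), ∀ β : ℝ, β₁ ≤ β → ∀ S : ℕ, S₀ ≤ S → ∀ n : ℕ, n ≤ S → |latticeConnectedCorr r.ρ β (2 * S + 1) A.F B.F n| ≤ C * Real.exp (-(m β * n))) → (∀ m₀ : ℝ, 0 < m₀ → ∀ᶠ β : ℝ in Filter.atTop, m β < m₀) → ∃ sch : SpeciesScheme (YMSpecies G), let μ := fun k : ℕ => wilsonMeasure (d := 4) (L := sch.side k) r.ρ (sch.β k); let LS := fun (k n : ℕ) (F : SchwartzMap (Fin n → EuclideanSpace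 ℝ (Fin 4)) ℂ) => (∫ U, ∑ x : Fin n → ↥(box 4 (sch.L k)), F (fun i => sch.a k • siteToE ↑(x i)) * ∏ i, ((sch.c r.curvature k * sch.a k ^ 4 * (r.curvature.F (configShift (-↑(x i)) (torusLift (sch.side k) U)) - sch.m r.curvature k) : ℝ) : ℂ) ∂μ k); Filter.Tendsto sch.β Filter.atTop Filter.atTop ∧ (∀ k : ℕ, sch.m r.curvature k = ∫ U, r.curvature.F (torusLift (sch.side k) U) ∂μ k) ∧ (∃ (s : ℕ) (α β : ℝ), ∀ (n : ℕ) (F : SchwartzMap (Fin n → EuclideanSpace ℝ (Fin 4)) ℂ), IsOffDiagonal F → ∀ᶠ k in Filter.atTop, ‖LS k n F‖ ≤ α * (n.factorial : ℝ) ^ β * schwartzNorm (n * s) F) ∧ (∃ (f g : SchwartzMap (Fin 1 → EuclideanSpace ℝ (Fin 4)) ℂ) (H : SchwartzMap (Fin (1 + 1) → EuclideanSpace ℝ (Fin 4)) ℂ), IsTimeOrdered f ∧ IsTimeOrdered g ∧ IsAppendTensorOf H (osAdjoint f) g ∧ ∃ δ : ℝ, 0 < δ ∧ ∀ᶠ k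 in Filter.atTop, δ ≤ ‖LS k (1 + 1) H‖) ∧ (∃ Δ : ℝ, 0 < Δ ∧ ∀ (n m : ℕ) (F : SchwartzMap (Fin n → EuclideanSpace ℝ (Fin 4)) ℂ) (G' : SchwartzMap (Fin m → EuclideanSpace ℝ (Fin 4)) ℂ), IsTimeOrdered F → IsTimeOrdered G' → ∃ C : ℝ, ∀ v : EuclideanSpace ℝ (Fin 4), 0 ≤ v 0 → ∀ᶠ k in Filter.atTop, ∀ H : SchwartzMap (Fin (n + m) → EuclideanSpace ℝ (Fin 4)) ℂ, IsAppendTensorOf H (osAdjoint F) (translateMulti v G') → ‖LS k (n + m) H - LS k n (osAdjoint F) * LS k m G'‖ ≤ C * Real.exp (-Δ * ‖v‖)) ∧ (∀ (N : ℕ) (deg : Fin N → ℕ) (F : (j : Fin N) → SchwartzMap (Fin (deg j) → EuclideanSpace ℝ (Fin 4)) ℂ), (∀ j, IsTimeOrdered (F j)) → ∀ H : (i j : Fin N) → SchwartzMap (Fin (deg i + deg j) → EuclideanSpace ℝ (Fin 4)) ℂ, (∀ i j, IsAppendTensorOf (H i j) (osAdjoint (F i)) (F j)) → ∀ ε : ℝ,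 0 < ε → ∀ᶠ k in Filter.atTop, -ε ≤ (∑ i, ∑ j, LS k (deg i + deg j) (H i j)).re ∧ |(∑ i, ∑ j, LS k (deg i + deg j) (H i j)).im| ≤ ε) ∧ (∃ Δ : ℝ, 0 < Δ ∧ HasLatticeMassGap r sch Δ) := by
  sorry

/-- **Stub 3 — non-Gaussianity of the curvature along a massive scaling sequence** (verbatim
`FlowLineStateSpace.CurvatureNonGaussianity`, stmt-9118, for an arbitrary Borel structure; XL):
given (VS), (UVB), (ND), (CL), some off-diagonal three-point value of the renormalised curvature
functionals stays `≥ δ > 0` frequently in `k`. -/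
theorem stub_curvatureNonGaussianity :
    ∀ (G : Type) [Group G] [TopologicalSpace G] [IsTopologicalGroup G] [CompactSpace G] [MeasurableSpace G] [BorelSpace G], IsCompactSimpleLieGroup G → ∀ (r : LatticeRep G) (sch : SpeciesScheme (YMSpecies G)), let μ := fun k : ℕ => wilsonMeasure (d := 4) (L := sch.side k) r.ρ (sch.β k); let LS := fun (k n : ℕ) (F : SchwartzMap (Fin n → EuclideanSpace ℝ (Fin 4)) ℂ) => (∫ U, ∑ x : Fin n → ↥(box 4 (sch.L k)), F (fun i => sch.a k • siteToE ↑(x i)) * ∏ i, ((sch.c r.curvature k * sch.a k ^ 4 * (r.curvature.F (configShift (-↑(x i)) (torusLift (sch.side k) U)) - sch.m r.curvature k) : ℝ) : ℂ) ∂μ k); (∀ k : ℕ, sch.m r.curvature k = ∫ U, r.curvature.F (torusLift (sch.side k) U) ∂μ k) → (∃ (s : ℕ) (α β : ℝ), ∀ (n : ℕ) (F : SchwartzMap (Fin n → EuclideanSpace ℝ (Fin 4)) ℂ), IsOffDiagonal F → ∀ᶠ k in Filter.atTop, ‖LS k n F‖ ≤ α * (n.factorial : ℝ) ^ β * schwartzNorm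 (n * s) F) → (∃ (f g : SchwartzMap (Fin 1 → EuclideanSpace ℝ (Fin 4)) ℂ) (H : SchwartzMap (Fin (1 + 1) → EuclideanSpace ℝ (Fin 4)) ℂ), IsTimeOrdered f ∧ IsTimeOrdered g ∧ IsAppendTensorOf H (osAdjoint f) g ∧ ∃ δ : ℝ, 0 < δ ∧ ∀ᶠ k in Filter.atTop, δ ≤ ‖LS k (1 + 1) H‖) → (∃ Δ : ℝ, 0 < Δ ∧ ∀ (n m : ℕ) (F : SchwartzMap (Fin n → EuclideanSpace ℝ (Fin 4)) ℂ) (G' : SchwartzMap (Fin m → EuclideanSpace ℝ (Fin 4)) ℂ), IsTimeOrdered F → IsTimeOrdered G' → ∃ C : ℝ, ∀ v : EuclideanSpace ℝ (Fin 4), 0 ≤ v 0 → ∀ᶠ k in Filter.atTop, ∀ H : SchwartzMap (Fin (n + m) → EuclideanSpace ℝ (Fin 4)) ℂ, IsAppendTensorOf H (osAdjoint F) (translateMulti v G') → ‖LS k (n + m) H - LS k n (osAdjoint F) * LS k m G'‖ ≤ C * Real.exp (-Δ * ‖v‖)) → ∃ (f g h : SchwartzMap (EuclideanSpace ℝ (Fin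 4)) ℂ) (F₃ : SchwartzMap (Fin 3 → EuclideanSpace ℝ (Fin 4)) ℂ), IsTensorOf F₃ ![f, g, h] ∧ IsOffDiagonal F₃ ∧ ∃ δ : ℝ, 0 < δ ∧ ∃ᶠ k in Filter.atTop, δ ≤ ‖LS k 3 F₃‖ := by
  sorry

/-- **Stub 4 — restoration of proper rotations on ⁰𝒮** (verbatim `FlowLineStateSpace.RotationRestoration`,
stmt-9119, for an arbitrary Borel structure; OPEN, the E1 complement): given (VS), (UVB), (ND), (CL),
`LS_k(R·F − F) → 0` for every off-diagonal tensor `F` and every `R ∈ SO(4)`. -/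
theorem stub_rotationRestoration :
    ∀ (G : Type) [Group G] [TopologicalSpace G] [IsTopologicalGroup G] [CompactSpace G] [MeasurableSpace G] [BorelSpace G], IsCompactSimpleLieGroup G → ∀ (r : LatticeRep G) (sch : SpeciesScheme (YMSpecies G)), let μ := fun k : ℕ => wilsonMeasure (d := 4) (L := sch.side k) r.ρ (sch.β k); let LS := fun (k n : ℕ) (F : SchwartzMap (Fin n → EuclideanSpace ℝ (Fin 4)) ℂ) => (∫ U, ∑ x : Fin n → ↥(box 4 (sch.L k)), F (fun i => sch.a k • siteToE ↑(x i)) * ∏ i, ((sch.c r.curvature k * sch.a k ^ 4 * (r.curvature.F (configShift (-↑(x i)) (torusLift (sch.side k) U)) - sch.m r.curvature k) : ℝ) : ℂ) ∂μ k); (∀ k : ℕ, sch.m r.curvature k = ∫ U, r.curvature.F (torusLift (sch.side k) U) ∂μ k) → (∃ (s : ℕ) (α β : ℝ), ∀ (n : ℕ) (F : SchwartzMap (Fin n → EuclideanSpace ℝ (Fin 4)) ℂ), IsOffDiagonal F → ∀ᶠ k in Filter.atTop, ‖LS k n F‖ ≤ α * (n.factorial : ℝ) ^ β * schwartzNorm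 (n * s) F) → (∃ (f g : SchwartzMap (Fin 1 → EuclideanSpace ℝ (Fin 4)) ℂ) (H : SchwartzMap (Fin (1 + 1) → EuclideanSpace ℝ (Fin 4)) ℂ), IsTimeOrdered f ∧ IsTimeOrdered g ∧ IsAppendTensorOf H (osAdjoint f) g ∧ ∃ δ : ℝ, 0 < δ ∧ ∀ᶠ k in Filter.atTop, δ ≤ ‖LS k (1 + 1) H‖) → (∃ Δ : ℝ, 0 < Δ ∧ ∀ (n m : ℕ) (F : SchwartzMap (Fin n → EuclideanSpace ℝ (Fin 4)) ℂ) (G' : SchwartzMap (Fin m → EuclideanSpace ℝ (Fin 4)) ℂ), IsTimeOrdered F → IsTimeOrdered G' → ∃ C : ℝ, ∀ v : EuclideanSpace ℝ (Fin 4), 0 ≤ v 0 → ∀ᶠ k in Filter.atTop, ∀ H : SchwartzMap (Fin (n + m) → EuclideanSpace ℝ (Fin 4)) ℂ, IsAppendTensorOf H (osAdjoint F) (translateMulti v G') → ‖LS k (n + m) H - LS k n (osAdjoint F) * LS k m G'‖ ≤ C * Real.exp (-Δ * ‖v‖)) → ∀ (n : ℕ) (F : SchwartzMap (Fin n → EuclideanSpace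 ℝ (Fin 4)) ℂ), IsOffDiagonal F → ∀ R : EuclideanSpace ℝ (Fin 4) ≃ₗᵢ[ℝ] EuclideanSpace ℝ (Fin 4), LinearMap.det (R.toLinearEquiv : EuclideanSpace ℝ (Fin 4) →ₗ[ℝ] EuclideanSpace ℝ (Fin 4)) = 1 → Filter.Tendsto (fun k : ℕ => LS k n (linActMulti R F - F)) Filter.atTop (nhds 0) := by
  sorry

/-- **Stub 5 — the soft OS assembly** (verbatim `FlowLineStateSpace.OSLimitFromUniformBounds`,
stmt-15926, for an arbitrary Borel structure; L): given (VS), (UVB), (ND), (CL), (ARP), (GAP) and the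
conclusions of stubs 3 and 4, a β-reindexing `sch'` of `sch` along some `φ → ∞` and `T : OSData` with
`IsYangMillsFor r sch' T`, non-trivial non-Gaussian curvature and `∃ Δ > 0, T.HasMassGap Δ ∧
HasLatticeMassGap r sch' Δ` (diagonal subsequence + Banach–Steinhaus + axioms through the limit). -/
theorem stub_osLimitFromUniformBounds :
    ∀ (G : Type) [Group G] [TopologicalSpace G] [IsTopologicalGroup G] [CompactSpace G] [MeasurableSpace G] [BorelSpace G], IsCompactSimpleLieGroup G → ∀ (r : LatticeRep G) (sch : SpeciesScheme (YMSpecies G)), let μ := fun k : ℕ => wilsonMeasure (d := 4) (L := sch.side k) r.ρ (sch.β k); let LS := fun (k n : ℕ) (F : SchwartzMap (Fin n → EuclideanSpace ℝ (Fin 4)) ℂ) => (∫ U, ∑ x : Fin n → ↥(box 4 (sch.L k)), F (fun i => sch.a k • siteToE ↑(x i)) * ∏ i, ((sch.c r.curvature k * sch.a k ^ 4 * (r.curvature.F (configShift (-↑(x i)) (torusLift (sch.side k) U)) - sch.m r.curvature k) : ℝ) : ℂ) ∂μ k); (∀ k : ℕ, sch.m r.curvature k = ∫ U, r.curvature.F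 (torusLift (sch.side k) U) ∂μ k) → (∃ (s : ℕ) (α β : ℝ), ∀ (n : ℕ) (F : SchwartzMap (Fin n → EuclideanSpace ℝ (Fin 4)) ℂ), IsOffDiagonal F → ∀ᶠ k in Filter.atTop, ‖LS k n F‖ ≤ α * (n.factorial : ℝ) ^ β * schwartzNorm (n * s) F) → (∃ (f g : SchwartzMap (Fin 1 → EuclideanSpace ℝ (Fin 4)) ℂ) (H : SchwartzMap (Fin (1 + 1) → EuclideanSpace ℝ (Fin 4)) ℂ), IsTimeOrdered f ∧ IsTimeOrdered g ∧ IsAppendTensorOf H (osAdjoint f) g ∧ ∃ δ : ℝ, 0 < δ ∧ ∀ᶠ k in Filter.atTop, δ ≤ ‖LS k (1 + 1) H‖) → (∃ Δ : ℝ, 0 < Δ ∧ ∀ (n m : ℕ) (F : SchwartzMap (Fin n → EuclideanSpace ℝ (Fin 4)) ℂ) (G' : SchwartzMap (Fin m → EuclideanSpace ℝ (Fin 4)) ℂ), IsTimeOrdered F → IsTimeOrdered G' → ∃ C : ℝ, ∀ v : EuclideanSpace ℝ (Fin 4), 0 ≤ v 0 → ∀ᶠ k in Filter.atTop, ∀ H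 : SchwartzMap (Fin (n + m) → EuclideanSpace ℝ (Fin 4)) ℂ, IsAppendTensorOf H (osAdjoint F) (translateMulti v G') → ‖LS k (n + m) H - LS k n (osAdjoint F) * LS k m G'‖ ≤ C * Real.exp (-Δ * ‖v‖)) → (∀ (N : ℕ) (deg : Fin N → ℕ) (F : (j : Fin N) → SchwartzMap (Fin (deg j) → EuclideanSpace ℝ (Fin 4)) ℂ), (∀ j, IsTimeOrdered (F j)) → ∀ H : (i j : Fin N) → SchwartzMap (Fin (deg i + deg j) → EuclideanSpace ℝ (Fin 4)) ℂ, (∀ i j, IsAppendTensorOf (H i j) (osAdjoint (F i)) (F j)) → ∀ ε : ℝ, 0 < ε → ∀ᶠ k in Filter.atTop, -ε ≤ (∑ i, ∑ j, LS k (deg i + deg j) (H i j)).re ∧ |(∑ i, ∑ j, LS k (deg i + deg j) (H i j)).im| ≤ ε) → (∃ Δ : ℝ, 0 < Δ ∧ HasLatticeMassGap r sch Δ) → (∃ (f g h : SchwartzMap (EuclideanSpace ℝ (Fin 4)) ℂ) (F₃ : SchwartzMap (Fin 3 → EuclideanSpace ℝ (Fin 4)) ℂ), IsTensorOf F₃ ![f,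 g, h] ∧ IsOffDiagonal F₃ ∧ ∃ δ : ℝ, 0 < δ ∧ ∃ᶠ k in Filter.atTop, δ ≤ ‖LS k 3 F₃‖) → (∀ (n : ℕ) (F : SchwartzMap (Fin n → EuclideanSpace ℝ (Fin 4)) ℂ), IsOffDiagonal F → ∀ R : EuclideanSpace ℝ (Fin 4) ≃ₗᵢ[ℝ] EuclideanSpace ℝ (Fin 4), LinearMap.det (R.toLinearEquiv : EuclideanSpace ℝ (Fin 4) →ₗ[ℝ] EuclideanSpace ℝ (Fin 4)) = 1 → Filter.Tendsto (fun k : ℕ => LS k n (linActMulti R F - F)) Filter.atTop (nhds 0)) → ∃ (sch' : SpeciesScheme (YMSpecies G)) (T : OSData (YMSpecies G) 4), (∃ φ : ℕ → ℕ, Filter.Tendsto φ Filter.atTop Filter.atTop ∧ ∀ k : ℕ, sch'.β k = sch.β (φ k)) ∧ IsYangMillsFor r sch' T ∧ T.IsNontrivial r.curvature ∧ T.IsNonGaussian r.curvature ∧ ∃ Δ > 0, T.HasMassGap Δ ∧ HasLatticeMassGap r sch' Δ := by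
  sorry

/-! ### Name-keyed aliases of the five stub STATEMENTS (hypotheses of the composition)

`Registered.stub_X` is the statement of `stub_X` (same text) under the registered stub's short name, so
that the native skeleton audit (hypotheses admissible iff registered obligations / declared stubs BY
NAME) accepts the implication form `GapToContinuum_of : Registered.stub_xiDiverges → … → GapToContinuum`
(device of `Summits/QuantumFields/QCD/Cruxes/RotationRestoration/Lines/birth.lean`).  `GapToContinuum_closed`
below kernel-checks that each alias IS the corresponding stub's type. -/
namespace Registered

/-- Alias of the statement of `stub_xiDiverges` keyed by the registered stub name. -/
abbrev stub_xiDiverges : Prop :=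
  ∀ (G : Type) [Group G] [TopologicalSpace G] [IsTopologicalGroup G] [CompactSpace G] [MeasurableSpace G] [BorelSpace G], IsCompactSimpleLieGroup G → ∀ (r : LatticeRep G) (β₁ : ℝ) (m : ℝ → ℝ), (∀ β : ℝ, β₁ ≤ β → 0 < m β) → (∀ A B : YMSpecies G, ∃ (C : ℝ) (S₀ : ℕ), ∀ β : ℝ, β₁ ≤ β → ∀ S : ℕ, S₀ ≤ S → ∀ n : ℕ, n ≤ S → |latticeConnectedCorr r.ρ β (2 * S + 1) A.F B.F n| ≤ C * Real.exp (-(m β * n))) → ∀ m₀ : ℝ, 0 < m₀ → ∀ᶠ β : ℝ in Filter.atTop, m β < m₀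

/-- Alias of the statement of `stub_massiveSchemeOfLatticeGap` keyed by the registered stub name. -/
abbrev stub_massiveSchemeOfLatticeGap : Prop :=
  ∀ (G : Type) [Group G] [TopologicalSpace G] [IsTopologicalGroup G] [CompactSpace G] [MeasurableSpace G] [BorelSpace G], IsCompactSimpleLieGroup G → ∀ (r : LatticeRep G) (β₁ : ℝ) (m : ℝ → ℝ), (∀ β : ℝ, β₁ ≤ β → 0 < m β) → (∀ A B : YMSpecies G, ∃ (C : ℝ) (S₀ : ℕ), ∀ β : ℝ, β₁ ≤ β → ∀ S : ℕ, S₀ ≤ S → ∀ n : ℕ, n ≤ S → |latticeConnectedCorr r.ρ β (2 * S + 1) A.F B.F n| ≤ C * Real.exp (-(m β * n))) → (∀ m₀ : ℝ, 0 < m₀ → ∀ᶠ β : ℝ in Filter.atTop, m β < m₀) → ∃ sch : SpeciesScheme (YMSpecies G), let μ := fun k : ℕ => wilsonMeasure (d := 4) (L := sch.side k) r.ρ (sch.β k); let LS := fun (k n : ℕ) (F : SchwartzMap (Fin n → EuclideanSpace ℝ (Fin 4)) ℂ) => (∫ U, ∑ x : Fin n → ↥(box 4 (sch.L k)), F (fun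 i => sch.a k • siteToE ↑(x i)) * ∏ i, ((sch.c r.curvature k * sch.a k ^ 4 * (r.curvature.F (configShift (-↑(x i)) (torusLift (sch.side k) U)) - sch.m r.curvature k) : ℝ) : ℂ) ∂μ k); Filter.Tendsto sch.β Filter.atTop Filter.atTop ∧ (∀ k : ℕ, sch.m r.curvature k = ∫ U, r.curvature.F (torusLift (sch.side k) U) ∂μ k) ∧ (∃ (s : ℕ) (α β : ℝ), ∀ (n : ℕ) (F : SchwartzMap (Fin n → EuclideanSpace ℝ (Fin 4)) ℂ), IsOffDiagonal F → ∀ᶠ k in Filter.atTop, ‖LS k n F‖ ≤ α * (n.factorial : ℝ) ^ β * schwartzNorm (n * s) F) ∧ (∃ (f g : SchwartzMap (Fin 1 → EuclideanSpace ℝ (Fin 4)) ℂ) (H : SchwartzMap (Fin (1 + 1) → EuclideanSpace ℝ (Fin 4)) ℂ), IsTimeOrdered f ∧ IsTimeOrdered g ∧ IsAppendTensorOf H (osAdjoint f) g ∧ ∃ δ : ℝ, 0 < δ ∧ ∀ᶠ k in Filter.atTop, δ ≤ ‖LS k (1 + 1) H‖) ∧ (∃ Δ : ℝ, 0 < Δ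 ∧ ∀ (n m : ℕ) (F : SchwartzMap (Fin n → EuclideanSpace ℝ (Fin 4)) ℂ) (G' : SchwartzMap (Fin m → EuclideanSpace ℝ (Fin 4)) ℂ), IsTimeOrdered F → IsTimeOrdered G' → ∃ C : ℝ, ∀ v : EuclideanSpace ℝ (Fin 4), 0 ≤ v 0 → ∀ᶠ k in Filter.atTop, ∀ H : SchwartzMap (Fin (n + m) → EuclideanSpace ℝ (Fin 4)) ℂ, IsAppendTensorOf H (osAdjoint F) (translateMulti v G') → ‖LS k (n + m) H - LS k n (osAdjoint F) * LS k m G'‖ ≤ C * Real.exp (-Δ * ‖v‖)) ∧ (∀ (N : ℕ) (deg : Fin N → ℕ) (F : (j : Fin N) → SchwartzMap (Fin (deg j) → EuclideanSpace ℝ (Fin 4)) ℂ), (∀ j, IsTimeOrdered (F j)) → ∀ H : (i j : Fin N) → SchwartzMap (Fin (deg i + deg j) → EuclideanSpace ℝ (Fin 4)) ℂ, (∀ i j, IsAppendTensorOf (H i j) (osAdjoint (F i)) (F j)) → ∀ ε : ℝ, 0 < ε → ∀ᶠ k in Filter.atTop, -ε ≤ (∑ i, ∑ j, LS k (deg i +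 deg j) (H i j)).re ∧ |(∑ i, ∑ j, LS k (deg i + deg j) (H i j)).im| ≤ ε) ∧ (∃ Δ : ℝ, 0 < Δ ∧ HasLatticeMassGap r sch Δ)

/-- Alias of the statement of `stub_curvatureNonGaussianity` keyed by the registered stub name. -/
abbrev stub_curvatureNonGaussianity : Prop :=
  ∀ (G : Type) [Group G] [TopologicalSpace G] [IsTopologicalGroup G] [CompactSpace G] [MeasurableSpace G] [BorelSpace G], IsCompactSimpleLieGroup G → ∀ (r : LatticeRep G) (sch : SpeciesScheme (YMSpecies G)), let μ := fun k : ℕ => wilsonMeasure (d := 4) (L := sch.side k) r.ρ (sch.β k); let LS := fun (k n : ℕ) (F : SchwartzMap (Fin n → EuclideanSpace ℝ (Fin 4)) ℂ) => (∫ U, ∑ x : Fin n → ↥(box 4 (sch.L k)), F (fun i => sch.a k • siteToE ↑(x i)) * ∏ i, ((sch.c r.curvature k * sch.a k ^ 4 * (r.curvature.F (configShift (-↑(x i)) (torusLift (sch.side k) U)) - sch.m r.curvature k) : ℝ) : ℂ) ∂μ k); (∀ k : ℕ, sch.m r.curvature k = ∫ U, r.curvature.F (torusLift (sch.side k) U)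 ∂μ k) → (∃ (s : ℕ) (α β : ℝ), ∀ (n : ℕ) (F : SchwartzMap (Fin n → EuclideanSpace ℝ (Fin 4)) ℂ), IsOffDiagonal F → ∀ᶠ k in Filter.atTop, ‖LS k n F‖ ≤ α * (n.factorial : ℝ) ^ β * schwartzNorm (n * s) F) → (∃ (f g : SchwartzMap (Fin 1 → EuclideanSpace ℝ (Fin 4)) ℂ) (H : SchwartzMap (Fin (1 + 1) → EuclideanSpace ℝ (Fin 4)) ℂ), IsTimeOrdered f ∧ IsTimeOrdered g ∧ IsAppendTensorOf H (osAdjoint f) g ∧ ∃ δ : ℝ, 0 < δ ∧ ∀ᶠ k in Filter.atTop, δ ≤ ‖LS k (1 + 1) H‖) → (∃ Δ : ℝ, 0 < Δ ∧ ∀ (n m : ℕ) (F : SchwartzMap (Fin n → EuclideanSpace ℝ (Fin 4)) ℂ) (G' : SchwartzMap (Fin m → EuclideanSpace ℝ (Fin 4)) ℂ), IsTimeOrdered F → IsTimeOrdered G' → ∃ C : ℝ, ∀ v : EuclideanSpace ℝ (Fin 4), 0 ≤ v 0 → ∀ᶠ k in Filter.atTop, ∀ H : SchwartzMap (Fin (n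 + m) → EuclideanSpace ℝ (Fin 4)) ℂ, IsAppendTensorOf H (osAdjoint F) (translateMulti v G') → ‖LS k (n + m) H - LS k n (osAdjoint F) * LS k m G'‖ ≤ C * Real.exp (-Δ * ‖v‖)) → ∃ (f g h : SchwartzMap (EuclideanSpace ℝ (Fin 4)) ℂ) (F₃ : SchwartzMap (Fin 3 → EuclideanSpace ℝ (Fin 4)) ℂ), IsTensorOf F₃ ![f, g, h] ∧ IsOffDiagonal F₃ ∧ ∃ δ : ℝ, 0 < δ ∧ ∃ᶠ k in Filter.atTop, δ ≤ ‖LS k 3 F₃‖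

/-- Alias of the statement of `stub_rotationRestoration` keyed by the registered stub name. -/
abbrev stub_rotationRestoration : Prop :=
  ∀ (G : Type) [Group G] [TopologicalSpace G] [IsTopologicalGroup G] [CompactSpace G] [MeasurableSpace G] [BorelSpace G], IsCompactSimpleLieGroup G → ∀ (r : LatticeRep G) (sch : SpeciesScheme (YMSpecies G)), let μ := fun k : ℕ => wilsonMeasure (d := 4) (L := sch.side k) r.ρ (sch.β k); let LS := fun (k n : ℕ) (F : SchwartzMap (Fin n → EuclideanSpace ℝ (Fin 4)) ℂ) => (∫ U, ∑ x : Fin n → ↥(box 4 (sch.L k)), F (fun i => sch.a k • siteToE ↑(x i)) * ∏ i, ((sch.c r.curvature k * sch.a k ^ 4 * (r.curvature.F (configShift (-↑(x i)) (torusLift (sch.side k) U)) - sch.m r.curvature k) : ℝ) : ℂ) ∂μ k); (∀ k : ℕ, sch.m r.curvature k = ∫ U, r.curvature.F (torusLift (sch.side k) U) ∂μ k) → (∃ (s : ℕ) (α β : ℝ), ∀ (n : ℕ) (F : SchwartzMap (Fin n → EuclideanSpace ℝ (Fin 4)) ℂ), IsOffDiagonal F → ∀ᶠ k in Filter.atTop,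 ‖LS k n F‖ ≤ α * (n.factorial : ℝ) ^ β * schwartzNorm (n * s) F) → (∃ (f g : SchwartzMap (Fin 1 → EuclideanSpace ℝ (Fin 4)) ℂ) (H : SchwartzMap (Fin (1 + 1) → EuclideanSpace ℝ (Fin 4)) ℂ), IsTimeOrdered f ∧ IsTimeOrdered g ∧ IsAppendTensorOf H (osAdjoint f) g ∧ ∃ δ : ℝ, 0 < δ ∧ ∀ᶠ k in Filter.atTop, δ ≤ ‖LS k (1 + 1) H‖) → (∃ Δ : ℝ, 0 < Δ ∧ ∀ (n m : ℕ) (F : SchwartzMap (Fin n → EuclideanSpace ℝ (Fin 4)) ℂ) (G' : SchwartzMap (Fin m → EuclideanSpace ℝ (Fin 4)) ℂ), IsTimeOrdered F → IsTimeOrdered G' → ∃ C : ℝ, ∀ v : EuclideanSpace ℝ (Fin 4), 0 ≤ v 0 → ∀ᶠ k in Filter.atTop, ∀ H : SchwartzMap (Fin (n + m) → EuclideanSpace ℝ (Fin 4)) ℂ, IsAppendTensorOf H (osAdjoint F) (translateMulti v G') → ‖LS k (n + m) H - LS k n (osAdjoint F) * LS k m G'‖ ≤ C * Real.exp (-Δ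 * ‖v‖)) → ∀ (n : ℕ) (F : SchwartzMap (Fin n → EuclideanSpace ℝ (Fin 4)) ℂ), IsOffDiagonal F → ∀ R : EuclideanSpace ℝ (Fin 4) ≃ₗᵢ[ℝ] EuclideanSpace ℝ (Fin 4), LinearMap.det (R.toLinearEquiv : EuclideanSpace ℝ (Fin 4) →ₗ[ℝ] EuclideanSpace ℝ (Fin 4)) = 1 → Filter.Tendsto (fun k : ℕ => LS k n (linActMulti R F - F)) Filter.atTop (nhds 0)

/-- Alias of the statement of `stub_osLimitFromUniformBounds` keyed by the registered stub name. -/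
abbrev stub_osLimitFromUniformBounds : Prop :=
  ∀ (G : Type) [Group G] [TopologicalSpace G] [IsTopologicalGroup G] [CompactSpace G] [MeasurableSpace G] [BorelSpace G], IsCompactSimpleLieGroup G → ∀ (r : LatticeRep G) (sch : SpeciesScheme (YMSpecies G)), let μ := fun k : ℕ => wilsonMeasure (d := 4) (L := sch.side k) r.ρ (sch.β k); let LS := fun (k n : ℕ) (F : SchwartzMap (Fin n → EuclideanSpace ℝ (Fin 4)) ℂ) => (∫ U, ∑ x : Fin n → ↥(box 4 (sch.L k)), F (fun i => sch.a k • siteToE ↑(x i)) * ∏ i, ((sch.c r.curvature k * sch.a k ^ 4 * (r.curvature.F (configShift (-↑(x i)) (torusLift (sch.side k) U)) - sch.m r.curvature k) : ℝ) : ℂ) ∂μ k); (∀ k : ℕ, sch.m r.curvature k = ∫ U, r.curvature.F (torusLift (sch.side k) U) ∂μ k) → (∃ (s : ℕ) (α β : ℝ), ∀ (n : ℕ) (F : SchwartzMap (Fin n → EuclideanSpace ℝ (Fin 4)) ℂ), IsOffDiagonal F → ∀ᶠ k in Filter.atTop, ‖LS k n F‖ ≤ α * (n.factorial : ℝ) ^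 β * schwartzNorm (n * s) F) → (∃ (f g : SchwartzMap (Fin 1 → EuclideanSpace ℝ (Fin 4)) ℂ) (H : SchwartzMap (Fin (1 + 1) → EuclideanSpace ℝ (Fin 4)) ℂ), IsTimeOrdered f ∧ IsTimeOrdered g ∧ IsAppendTensorOf H (osAdjoint f) g ∧ ∃ δ : ℝ, 0 < δ ∧ ∀ᶠ k in Filter.atTop, δ ≤ ‖LS k (1 + 1) H‖) → (∃ Δ : ℝ, 0 < Δ ∧ ∀ (n m : ℕ) (F : SchwartzMap (Fin n → EuclideanSpace ℝ (Fin 4)) ℂ) (G' : SchwartzMap (Fin m → EuclideanSpace ℝ (Fin 4)) ℂ), IsTimeOrdered F → IsTimeOrdered G' → ∃ C : ℝ, ∀ v : EuclideanSpace ℝ (Fin 4), 0 ≤ v 0 → ∀ᶠ k in Filter.atTop, ∀ H : SchwartzMap (Fin (n + m) → EuclideanSpace ℝ (Fin 4)) ℂ, IsAppendTensorOf H (osAdjoint F) (translateMulti v G') → ‖LS k (n + m) H - LS k n (osAdjoint F) * LS k m G'‖ ≤ C * Real.exp (-Δ * ‖v‖)) → (∀ (N : ℕ) (deg : Fin N →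 ℕ) (F : (j : Fin N) → SchwartzMap (Fin (deg j) → EuclideanSpace ℝ (Fin 4)) ℂ), (∀ j, IsTimeOrdered (F j)) → ∀ H : (i j : Fin N) → SchwartzMap (Fin (deg i + deg j) → EuclideanSpace ℝ (Fin 4)) ℂ, (∀ i j, IsAppendTensorOf (H i j) (osAdjoint (F i)) (F j)) → ∀ ε : ℝ, 0 < ε → ∀ᶠ k in Filter.atTop, -ε ≤ (∑ i, ∑ j, LS k (deg i + deg j) (H i j)).re ∧ |(∑ i, ∑ j, LS k (deg i + deg j) (H i j)).im| ≤ ε) → (∃ Δ : ℝ, 0 < Δ ∧ HasLatticeMassGap r sch Δ) → (∃ (f g h : SchwartzMap (EuclideanSpace ℝ (Fin 4)) ℂ) (F₃ : SchwartzMap (Fin 3 → EuclideanSpace ℝ (Fin 4)) ℂ), IsTensorOf F₃ ![f, g, h] ∧ IsOffDiagonal F₃ ∧ ∃ δ : ℝ, 0 < δ ∧ ∃ᶠ k in Filter.atTop, δ ≤ ‖LS k 3 F₃‖) → (∀ (n : ℕ) (F : SchwartzMap (Fin n → EuclideanSpace ℝ (Fin 4)) ℂ), IsOffDiagonal F → ∀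 R : EuclideanSpace ℝ (Fin 4) ≃ₗᵢ[ℝ] EuclideanSpace ℝ (Fin 4), LinearMap.det (R.toLinearEquiv : EuclideanSpace ℝ (Fin 4) →ₗ[ℝ] EuclideanSpace ℝ (Fin 4)) = 1 → Filter.Tendsto (fun k : ℕ => LS k n (linActMulti R F - F)) Filter.atTop (nhds 0)) → ∃ (sch' : SpeciesScheme (YMSpecies G)) (T : OSData (YMSpecies G) 4), (∃ φ : ℕ → ℕ, Filter.Tendsto φ Filter.atTop Filter.atTop ∧ ∀ k : ℕ, sch'.β k = sch.β (φ k)) ∧ IsYangMillsFor r sch' T ∧ T.IsNontrivial r.curvature ∧ T.IsNonGaussian r.curvature ∧ ∃ Δ > 0, T.HasMassGap Δ ∧ HasLatticeMassGap r sch' Δ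

end Registered

/-- **Composition** (a REAL proof, pure logic — the pointwise-in-`r` version of
`FlowLineStateSpace.closes`): the five stub STATEMENTS (name-keyed aliases `Registered.stub_*`, no
reference to the sorried theorems) imply the crux BY NAME; `#print axioms` = propext, Classical.choice,
Quot.sound.  Open (L); stub 1 gives
ξ-divergence of its rate; stub 2 the massive scheme `sch`; stubs 3, 4 its κ₃ and O(4) clauses; stub 5
the OS data `T` along a β-reindexing `sch'` of `sch`; `sch'.HasWeakCouplingLimit` is `(AF) ∘ φ`. -/
theorem GapToContinuum_of (h₁ : Registered.stub_xiDiverges)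
    (h₂ : Registered.stub_massiveSchemeOfLatticeGap) (h₃ : Registered.stub_curvatureNonGaussianity)
    (h₄ : Registered.stub_rotationRestoration) (h₅ : Registered.stub_osLimitFromUniformBounds) :
    Summit.QuantumFields.YangMills.Theses.InfraredLiouville.GapToContinuum := by
  intro G _ _ _ _ _ _ hG r hL
  obtain ⟨β₁, m, hpos, hclust⟩ := hL
  have hxi := h₁ G hG r β₁ m hpos hclust
  obtain ⟨sch, hAF, hVS, hUVB, hND, hCL, hARP, hGAP⟩ := h₂ G hG r β₁ m hpos hclust hxi
  have hNG := h₃ G hG r sch hVS hUVB hND hCL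
  have hROT := h₄ G hG r sch hVS hUVB hND hCL
  obtain ⟨sch', T, ⟨φ, hφ, hβ⟩, hYM, hNT, hNGs, hGap⟩ :=
    h₅ G hG r sch hVS hUVB hND hCL hARP hGAP hNG hROT
  refine ⟨sch', T, ?_, hYM, hNT, hNGs, hGap⟩
  have hb : sch'.β = sch.β ∘ φ := funext hβ
  show Filter.Tendsto sch'.β Filter.atTop Filter.atTop
  rw [hb]
  exact hAF.comp hφ

/-- **Closed form**: the five stubs BY NAME instantiate the composition's antecedents (kernel check that
the antecedent texts are the stub signatures); concludes the crux by name. -/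
theorem GapToContinuum_closed : Summit.QuantumFields.YangMills.Theses.InfraredLiouville.GapToContinuum :=
  GapToContinuum_of stub_xiDiverges stub_massiveSchemeOfLatticeGap stub_curvatureNonGaussianity
    stub_rotationRestoration stub_osLimitFromUniformBounds

end Summit.QuantumFields.YangMills.Cruxes.GapToContinuum.Birth15914

end
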